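/-
Origin: expansion seat `prover-pub-hodgecm-mc-binder-2-g11-0`, handover #38 2026-08-20T02:55Z md5 82b82c35bbb6 (142 l.; CERTIFIED rc 0 / 0 warn / 50.9 s; imports #36 + discharge-3's RUN-36 `HypCensus/ArchDatumBlockFramesCM`; `cmXW_cmPlace_apply`, `cmXW_cmPlace_pos_or_neg` (W definite at ι₁ ⇒ ONE reading), `iotaFrameA` (= `cmPosIdxEquivFin⁻¹`), `iotaQ₀` (= `cmNegIdxEquivUnit⁻¹ ()`), **`jIAt`** (THE variable identification of the printed ι₁ model, by cases on the W-reading: `z ↦ (V⁺,W)`, `w ↦ (V⁻,W)`), **`dIotaAt u`** (`c₀c₁` or `conj(c₀c₁)`), **`linSubst_torusLetter_placePoly_vacuum_iotaAt`** (the ι₁ det-line eigen-equation for any datum family equal to `iota jIAt` at the ι₁ place — hypothesis-free given `h21`, `hWι`); NAME LIST `HodgeCM.Model.HypCensus.jIAt`, `HodgeCM.Model.HypCensus.dIotaAt`, `HodgeCM.Model.HypCensus.linSubst_torusLetter_placePoly_vacuum_iotaAt`; axioms trio) (`HOME/mc/pub-hodgecm-mc-binder-2/g11/pkg/HodgeCM/Model/HypCensus/OmgInsIotaChoice.lean`,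 md5 82b82c35bbb6, 142 lines);
landed by the gen-14 packager (p-g14) in gate run 39 as `HodgeCM/Model/HypCensus/OmgInsIotaChoice.lean` (verbatim).
-/
/-
Origin: speedrun cell pub-hodgecm, MODEL-CONSTRUCTION sub-cell, lineage mc-binder-2 (BINDER-OWNERS rows 18/19: E binders
`hyp12` / `hyp34` of `Model.perL_picardCM_r15A`), seat prover-pub-hodgecm-mc-binder-2-g11-0 (gen 11), 2026-08-20.
Target in PKG: `HodgeCM/Model/HypCensus/OmgInsIotaChoice.lean` (NEW additive leaf; imports this lineage's `HypCensus/OmgInsIota` (gen 11) and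
discharge-3's RUN-36 INSTALLED `HypCensus/ArchDatumBlockFramesCM` (the canonical `V`-frames at the place under `ι₁`)).
KERNEL ONLY: 0 records, nothing cited as hypothesis, 0 `def … : Prop`; three data defs (`Classical` case splits) + theorems.
-/
import Summits.HodgeConjecture.HodgeCM.Model.HypCensus.OmgInsIota
import Summits.HodgeConjecture.HodgeCM.Model.HypCensus.ArchDatumBlockFramesCM

/-!
# Census kit (rows A12/A34), (J-T12) at `φ₀`: THE variable identification at `ι₁` and THE `ι₁` scalar, chosen from the sign facts

`OmgInsIota` proves the `ι₁` det-line eigen-equation for a datum `iota jI` with the CORRECT `jI`, in both `W`-readings.  This leaf CHOOSES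
`jI` and the scalar from the sign facts of the pin alone (V of signature `(2,1)` at `ι₁` — `h21`, W definite at `ι₁` — `hWι`):

* `cmXW_cmPlace_pos_or_neg` — at the place under `ι₁` the `W`-sign vector has ONE strict sign (so exactly one reading applies);
* **`jIAt … : PlaneVar → Fin 6`** — `z_{aj} ↦ (V⁺_a, W_j)`, `w_j ↦ (V⁻, W_j)` in the reading that applies (frames `cmPosIdxEquivFin` /
  `cmNegIdxEquivUnit` of discharge-3, `pos/negReadingEquiv`);
* **`dIotaAt … u : ℂ`** — `c₀c₁` (positive reading) or `conj(c₀c₁)` (negative reading), `c_j = ι_{w(ι₁)}(u_j)`;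
* **`linSubst_torusLetter_placePoly_vacuum_iotaAt`** — for every datum family with `datum b₁ = iota jIAt` at the `ι₁` place: the inserted
  `det z` is a torus-letter eigenvector with eigenvalue `dIotaAt u` (= the hypothesis `hdι` of `OmgInsPin` at that place, hypothesis-free).

Nothing here is a claim of PerL/QW8.  Style lint (L-notation): no `local notation`.
-/

set_option autoImplicit false

noncomputable section

open NumberField NumberField.InfinitePlace IsDedekindDomain
open scoped Matrix Kronecker Classical TensorProduct ComplexConjugate
open MvPolynomial
open Literature.NumberTheory.Automorphic Literature.NumberTheory.Automorphic.UnitaryGroup Literature.NumberTheory.Weil1964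
open Literature.RepresentationTheory.HeisenbergGroup (polar symplecticGroup)
open Literature.RepresentationTheory.KonnoKonno2007 Literature.RepresentationTheory.KonnoKonno2007.RealDualPair
open Literature.NumberTheory.GelbartRogawski1991 Literature.NumberTheory.GelbartRogawski1991.UnitaryDualPair
open Literature.RepresentationTheory (atPlace)
open Literature.Analysis.SegalBargmann
open HodgeCM.PerL34.Fock HodgeCM.PerL34.Fock.PrintDict

namespace HodgeCM.Model.HypCensus

section IotaChoice

variable (L : Type) [Field L] [NumberField L] [IsCMField L]
variable (dV : Fin 3 → L) (hdV : ∀ i, IsCMField.complexConj L (dV i) = dV i)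
variable (dW : Fin 2 → L) (hdW : ∀ i, IsCMField.complexConj L (dW i) = dW i)
variable (ι₁ : L →+* ℂ)
variable (h21 : ∃ i₀ : Fin 3, (ι₁ (dV i₀)).re < 0 ∧ ∀ i, i ≠ i₀ → 0 < (ι₁ (dV i)).re)
variable (hWι : (∀ j, 0 < (ι₁ (dW j)).re) ∨ ∀ j, (ι₁ (dW j)).re < 0)

/-- the canonical `W`-sign vector at the place under `ι₁` is `j ↦ re ι₁(a_j) / c_W`. -/
theorem cmXW_cmPlace_apply (j : Fin 2) :
    cmXW L dV dW hdW ι₁ (cmPlace L ι₁) j = (ι₁ (dW j)).re / cmCW L dV ι₁ (cmPlace L ι₁) :=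
  placeSignVec_cmRealVec L (cmPlace L ι₁) ι₁ rfl dW hdW (cmCW L dV ι₁) j

include hWι in
/-- **at the place under `ι₁` the `W`-block is read with ONE sign** (W is definite there): all positive or all non-positive. -/
theorem cmXW_cmPlace_pos_or_neg :
    (∀ j, 0 < cmXW L dV dW hdW ι₁ (cmPlace L ι₁) j) ∨ ∀ j, ¬0 < cmXW L dV dW hdW ι₁ (cmPlace L ι₁) j := by
  rcases forall_pos_or_forall_neg_div hWι (cmCW_ne_zero L dV ι₁ (cmPlace L ι₁)) with h | h
  · exact Or.inl fun j => by rw [cmXW_cmPlace_apply]; exact h j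
  · exact Or.inr fun j => by rw [cmXW_cmPlace_apply]; exact not_lt.2 (h j).le

/-- the frame `Fin 2 ≃ V⁺` at the place under `ι₁` (discharge-3's `cmPosIdxEquivFin`, inverted). -/
def iotaFrameA : Fin 2 ≃ PosIdx (cmXV L dV hdV ι₁ (cmPlace L ι₁)) := (cmPosIdxEquivFin L dV hdV ι₁ h21).symm

/-- the `V⁻` index at the place under `ι₁`. -/
def iotaQ₀ : NegIdx (cmXV L dV hdV ι₁ (cmPlace L ι₁)) := (cmNegIdxEquivUnit L dV hdV ι₁ h21).symm ()

/-- **THE variable identification of the printed `ι₁` model**: `z_{aj} ↦ (V⁺_a, W_j)`, `w_j ↦ (V⁻, W_j)`, read in the `W`-reading that applies. -/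
def jIAt : HodgeCM.PerL34.Fock.PlaneVar → Fin 6 :=
  if hR : ∀ j, 0 < cmXW L dV dW hdW ι₁ (cmPlace L ι₁) j then
    (pairFrame (PosIdx (cmXV L dV hdV ι₁ (cmPlace L ι₁))) (NegIdx (cmXV L dV hdV ι₁ (cmPlace L ι₁)))
        (PosIdx (cmXW L dV dW hdW ι₁ (cmPlace L ι₁))) (NegIdx (cmXW L dV dW hdW ι₁ (cmPlace L ι₁))) finProdFinEquiv
        (cmEpsV L dV hdV ι₁ (cmPlace L ι₁)) (cmEpsW L dV dW hdW ι₁ (cmPlace L ι₁))).symm ∘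
      planeToDPIdx (iotaFrameA L dV hdV ι₁ h21) (posReadingEquiv hR) (iotaQ₀ L dV hdV ι₁ h21)
        (NegIdx (cmXW L dV dW hdW ι₁ (cmPlace L ι₁)))
  else
    (pairFrame (PosIdx (cmXV L dV hdV ι₁ (cmPlace L ι₁))) (NegIdx (cmXV L dV hdV ι₁ (cmPlace L ι₁)))
        (PosIdx (cmXW L dV dW hdW ι₁ (cmPlace L ι₁))) (NegIdx (cmXW L dV dW hdW ι₁ (cmPlace L ι₁))) finProdFinEquiv
        (cmEpsV L dV hdV ι₁ (cmPlace L ι₁)) (cmEpsW L dV dW hdW ι₁ (cmPlace L ι₁))).symm ∘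
      planeToDPIdxS (iotaFrameA L dV hdV ι₁ h21)
        (negReadingEquiv ((cmXW_cmPlace_pos_or_neg L dV dW hdW ι₁ hWι).resolve_left hR)) (iotaQ₀ L dV hdV ι₁ h21)
        (PosIdx (cmXW L dV dW hdW ι₁ (cmPlace L ι₁)))

/-- **THE `ι₁` torus scalar**: `c₀c₁` if `W` reads positive at `ι₁`, `conj(c₀c₁)` if negative (`c_j = ι_{w(ι₁)}(u_j)`). -/
def dIotaAt (u : SeesawArchTorus L) : ℂ :=
  if ∀ j, 0 < cmXW L dV dW hdW ι₁ (cmPlace L ι₁) j then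
    ((torusPlaceCircles L (cmPlace L ι₁) u 0 : Circle) : ℂ) * ((torusPlaceCircles L (cmPlace L ι₁) u 1 : Circle) : ℂ)
  else
    star ((torusPlaceCircles L (cmPlace L ι₁) u 0 : Circle) : ℂ) * star ((torusPlaceCircles L (cmPlace L ι₁) u 1 : Circle) : ℂ)

variable (hdV0 : ∀ i, dV i ≠ 0) (hdW0 : ∀ i, dW i ≠ 0)
variable (datum : ∀ b : InfinitePlace L, PlaceDatum L dV hdV dW hdW ι₁ (cmPlacesEquiv L b)) (m₁ m₂ : InfinitePlace L → ℤ)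

/-- **the `ι₁` eigen-equation with the CHOSEN identification**: for a datum family that is `iota jIAt` at the place under `ι₁`, the inserted
`det z` is a torus-letter eigenvector with eigenvalue `dIotaAt u`, in whichever `W`-reading applies. -/
theorem linSubst_torusLetter_placePoly_vacuum_iotaAt
    (hι : datum ((cmPlacesEquiv L).symm (cmPlace L ι₁)) = PlaceDatum.iota (jIAt L dV hdV dW hdW ι₁ h21 hWι))
    (u : SeesawArchTorus L) :
    linSubst (star ((reindexUnitary (pairFrame (PosIdx (cmXV L dV hdV ι₁ (cmPlace L ι₁))) (NegIdx (cmXV L dV hdV ι₁ (cmPlace L ι₁)))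
        (PosIdx (cmXW L dV dW hdW ι₁ (cmPlace L ι₁))) (NegIdx (cmXW L dV dW hdW ι₁ (cmPlace L ι₁))) finProdFinEquiv
        (cmEpsV L dV hdV ι₁ (cmPlace L ι₁)) (cmEpsW L dV dW hdW ι₁ (cmPlace L ι₁)))
        (dualPairι (torusPlaceLetter L dV hdV dW hdW ι₁ (cmPlace L ι₁) u)) : Matrix.unitaryGroup (Fin 6) ℂ) : Matrix (Fin 6) (Fin 6) ℂ))
        (placePoly L dV hdV dW hdW ι₁ datum m₁ m₂
          (fun b => ((printPlaces (InfinitePlace L) (kindOf L dV hdV dW hdW ι₁ datum) (lamOf L dV hdV dW hdW ι₁ datum)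
            (lamOf_ne_zero L dV hdV dW hdW ι₁ datum) (pinnedVacs (kindOf L dV hdV dW hdW ι₁ datum) m₁ m₂)).loc b).φ) (cmPlace L ι₁)) =
      dIotaAt L dV dW hdW ι₁ u • placePoly L dV hdV dW hdW ι₁ datum m₁ m₂
          (fun b => ((printPlaces (InfinitePlace L) (kindOf L dV hdV dW hdW ι₁ datum) (lamOf L dV hdV dW hdW ι₁ datum)
            (lamOf_ne_zero L dV hdV dW hdW ι₁ datum) (pinnedVacs (kindOf L dV hdV dW hdW ι₁ datum) m₁ m₂)).loc b).φ) (cmPlace L ι₁) := by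
  by_cases hR : ∀ j, 0 < cmXW L dV dW hdW ι₁ (cmPlace L ι₁) j
  · have hj : jIAt L dV hdV dW hdW ι₁ h21 hWι = (pairFrame (PosIdx (cmXV L dV hdV ι₁ (cmPlace L ι₁)))
        (NegIdx (cmXV L dV hdV ι₁ (cmPlace L ι₁))) (PosIdx (cmXW L dV dW hdW ι₁ (cmPlace L ι₁)))
        (NegIdx (cmXW L dV dW hdW ι₁ (cmPlace L ι₁))) finProdFinEquiv (cmEpsV L dV hdV ι₁ (cmPlace L ι₁))
        (cmEpsW L dV dW hdW ι₁ (cmPlace L ι₁))).symm ∘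
        planeToDPIdx (iotaFrameA L dV hdV ι₁ h21) (posReadingEquiv hR) (iotaQ₀ L dV hdV ι₁ h21)
          (NegIdx (cmXW L dV dW hdW ι₁ (cmPlace L ι₁))) := by
      unfold jIAt; rw [dif_pos hR]
    rw [dIotaAt, if_pos hR]
    rw [hj] at hι
    exact linSubst_torusLetter_placePoly_vacuum_iota L dV hdV dW hdW ι₁ datum m₁ m₂ (cmPlace L ι₁) hR
      (iotaFrameA L dV hdV ι₁ h21) (iotaQ₀ L dV hdV ι₁ h21) _ (fun x => by rw [Function.comp_apply, Equiv.apply_symm_apply]) hι u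
  · have hS : ∀ j, ¬0 < cmXW L dV dW hdW ι₁ (cmPlace L ι₁) j := (cmXW_cmPlace_pos_or_neg L dV dW hdW ι₁ hWι).resolve_left hR
    have hj : jIAt L dV hdV dW hdW ι₁ h21 hWι = (pairFrame (PosIdx (cmXV L dV hdV ι₁ (cmPlace L ι₁)))
        (NegIdx (cmXV L dV hdV ι₁ (cmPlace L ι₁))) (PosIdx (cmXW L dV dW hdW ι₁ (cmPlace L ι₁)))
        (NegIdx (cmXW L dV dW hdW ι₁ (cmPlace L ι₁))) finProdFinEquiv (cmEpsV L dV hdV ι₁ (cmPlace L ι₁))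
        (cmEpsW L dV dW hdW ι₁ (cmPlace L ι₁))).symm ∘
        planeToDPIdxS (iotaFrameA L dV hdV ι₁ h21) (negReadingEquiv hS) (iotaQ₀ L dV hdV ι₁ h21)
          (PosIdx (cmXW L dV dW hdW ι₁ (cmPlace L ι₁))) := by
      unfold jIAt; rw [dif_neg hR]
    rw [dIotaAt, if_neg hR]
    rw [hj] at hι
    exact linSubst_torusLetter_placePoly_vacuum_iota_neg L dV hdV dW hdW ι₁ datum m₁ m₂ (cmPlace L ι₁) hS
      (iotaFrameA L dV hdV ι₁ h21) (iotaQ₀ L dV hdV ι₁ h21) _ (fun x => by rw [Function.comp_apply, Equiv.apply_symm_apply]) hι u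

end IotaChoice

end HodgeCM.Model.HypCensus

end
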